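import Literature.NumberTheory.Transcendental.ExpGridAuxiliary
import Literature.NumberTheory.Transcendental.SixExponentialsSeveralVariablesCor42Proofs
import Literature.NumberTheory.Transcendental.DiazZeroLemmaMult
import HarnessLib

/-!
# The five exponentials theorem, direct proof — III: derivatives, Cauchy and Liouville

Topic `Literature/NumberTheory/Transcendental`; sibling proof file of `FiveExponentials.lean`
(the named fact `waldschmidt1988_fiveExponentials`, [Waldschmidt1988, §2 c) Corollary 2.2]) and of
`FiveExponentialsZeroEstimate.lean` (part I, whose module docstring describes the whole route).
Everything here is PROVED; there are no new definitions and no new facts.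

This is the arithmetic half of "§6, Proposition 6.1" of [Waldschmidt1988] in the configuration of
Corollary 2.2 ("the estimates for the derivatives are provided by Lemma 7 of D. Bertrand in
Appendix 1 of [14]"; here: Cauchy's inequalities in the single direction `W`, and Liouville's
inequality). With the notation of part II — `F(s, w) = ∑ p(a,b,c) w^a e^{-bw} e^{(b+cκ)s}`,
`κ = λ/γ`, the polynomial `P = ∑ p(a,b,c) X₀^a X₁^b X₂^c ∈ ℤ[X₀, X₁, X₂]` — and the points of part I
— `σ(μ) = (μ₂γ; e^{γ(μ₀y₀+μ₁y₁)}, e^{λ(μ₀y₀+μ₁y₁+μ₂)}) ∈ 𝔾ₐ × 𝔾ₘ²`,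
`s_μ = γ(μ₀y₀ + μ₁y₁ + μ₂)`, `w_μ = μ₂γ` — we prove:

* `evalAt_auxP_sig_mul_exp` — along the one-parameter subgroup `exp_G(τ(1; -1, 0))` through
  `σ(μ)` the polynomial `P` IS the auxiliary function: `P(σ(μ)·exp_G(τ(1;-1,0))) = F(s_μ, w_μ + τ)`;
* `iteratedDeriv_F_eq_aeval` — the `t`-th `τ`-derivative at `0` of `F(s_μ, w_μ + τ)` is the value
  at the algebraic point `(γ, e^{γy₀}, e^{γy₁}, e^{λy₀}, e^{λy₁}, e^{λ})` of an explicit INTEGER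
  polynomial `Q_{t,μ} = ∑ p(a,b,c) · (step_{-b}^t X^a)(μ₂ X_γ) · X_{β₀}^{bμ₀} X_{β₁}^{bμ₁}
  X_{α₀}^{cμ₀} X_{α₁}^{cμ₁} X_{α}^{cμ₂}`, using Baker's device `step_w Q = Q' + wQ`
  (`ExpGrid.iteratedDeriv_expMono`: `(d/dz)^t [Q(z)e^{wz}] = (step_w^t Q)(z) e^{wz}`), with
  `deg Q_{t,μ} ≤ t + D₀ + 5D₁·max μ_k` and `L(Q_{t,μ}) ≤ D₀D₁²P_b (D₀+D₁)^t (max μ_k + 1)^{D₀}`;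
* `derivs_eq_zero` — if `|F| ≤ ε` on the polydisc `|s|, |w| ≤ R` containing the points and the unit
  `w`-discs around them, then `|(d/dτ)^t F(s_μ, w_μ + τ)|_{τ=0}| ≤ t!·ε` (Cauchy,
  `Complex.norm_iteratedDeriv_le_of_forall_mem_sphere_norm_le`), and Liouville's inequality in
  `K = ℚ(γ, e^{γy_j}, e^{λy_j}, e^{λ})` (`AlgGens.aeval_eq_zero_of_norm_lt`) forces these
  derivatives to VANISH for `t ≤ 3T`, `max μ_k ≤ 3B`, as soon as `(3T)!·ε` is below the Liouville
  threshold — which is the vanishing hypothesis of part I (`zeroEstimate_fiveExp`).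

## References

* [Waldschmidt1988] M. Waldschmidt, *On the transcendence methods of Gel'fond and Schneider in
  several variables*, New Advances in Transcendence Theory (A. Baker ed.), CUP 1988, 375–398:
  §6 Proposition 6.1 (pp. 388–389); held scan `book:baker1988-new-advances-transcendence-theory`,
  pp. 310–311.
* [Baker1975] A. Baker, *Transcendental Number Theory*, CUP 1975, Ch. 2 Lemma 3 (Liouville),
  Ch. 12 §5 (value polynomials).
-/

noncomputable section

open Complex Finset

namespace Literature.NumberTheory.Transcendental.Waldschmidt1988

open Literature.NumberTheory.Transcendental.Chudnovsky (wnorm wnorm_nonneg wnorm_mul_le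
  wnorm_pow_le wnorm_X_pow_le wnorm_sum_le wnorm_C le_wnorm l1 pwnorm pwnorm_nonneg l1Seminorm)
open Literature.NumberTheory.Transcendental.ExpGrid (step expMono iterate_step_map
  iteratedDeriv_expMono contDiff_expMono natDegree_iterate_step_le totalDegree_coeff_step_le
  totalDegree_eval_le totalDegree_natCast plen plen_step_le l1_eval_le l1_natCast l1_X
  l1Seminorm_one_le)
open GaGm DiazZL DiazZLM

/-! ### The auxiliary polynomial `P = ∑ p(a,b,c) X₀^a X₁^b X₂^c` -/

section AuxPoly

variable {D₀ D₁ : ℕ}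

/-- The exponent vector `(a, b, c)` of the index `l`, evaluated. [folklore] -/
theorem expvec_apply (l : Fin D₀ × Fin D₁ × Fin D₁) (i : Fin 3) :
    (Finsupp.equivFunOnFinite.symm (![(l.1 : ℕ), (l.2.1 : ℕ), (l.2.2 : ℕ)] : Fin 3 → ℕ)) i =
      (![(l.1 : ℕ), (l.2.1 : ℕ), (l.2.2 : ℕ)] : Fin 3 → ℕ) i := by
  simp

/-- The exponent map `l ↦ (a, b, c)` is injective. [folklore] -/
theorem expvec_injective :
    Function.Injective fun l : Fin D₀ × Fin D₁ × Fin D₁ =>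
      Finsupp.equivFunOnFinite.symm (![(l.1 : ℕ), (l.2.1 : ℕ), (l.2.2 : ℕ)] : Fin 3 → ℕ) := by
  intro l l' h
  have h' := congrArg (fun f : Fin 3 →₀ ℕ => (f : Fin 3 → ℕ)) h
  simp only [Finsupp.coe_equivFunOnFinite_symm] at h'
  have h0 := congrFun h' 0
  have h1 := congrFun h' 1
  have h2 := congrFun h' 2
  simp only [Matrix.cons_val_zero, Matrix.cons_val_one, Matrix.cons_val] at h0 h1 h2
  ext <;> simp_all

/-- The coefficient of `X^{(a,b,c)}` in `P` is `p(a,b,c)`. [folklore] -/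
theorem coeff_auxP (p : Fin D₀ × Fin D₁ × Fin D₁ → ℤ) (l : Fin D₀ × Fin D₁ × Fin D₁) :
    (∑ l', MvPolynomial.monomial
        (Finsupp.equivFunOnFinite.symm (![(l'.1 : ℕ), (l'.2.1 : ℕ), (l'.2.2 : ℕ)] : Fin 3 → ℕ))
        ((p l' : ℤ) : ℂ)).coeff
      (Finsupp.equivFunOnFinite.symm (![(l.1 : ℕ), (l.2.1 : ℕ), (l.2.2 : ℕ)] : Fin 3 → ℕ)) =
      (p l : ℂ) := by
  classical
  simp only [MvPolynomial.coeff_sum, MvPolynomial.coeff_monomial]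
  rw [Finset.sum_eq_single l]
  · simp
  · intro b _ hb
    rw [if_neg]
    exact fun h => hb (expvec_injective h)
  · intro h
    exact absurd (Finset.mem_univ l) h

/-- Exponents not of the form `(a, b, c)` do not occur. [folklore] -/
theorem coeff_auxP_eq_zero (p : Fin D₀ × Fin D₁ × Fin D₁ → ℤ) (m : Fin 3 →₀ ℕ)
    (hm : ∀ l : Fin D₀ × Fin D₁ × Fin D₁,
      Finsupp.equivFunOnFinite.symm (![(l.1 : ℕ), (l.2.1 : ℕ), (l.2.2 : ℕ)] : Fin 3 → ℕ) ≠ m) :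
    (∑ l', MvPolynomial.monomial
        (Finsupp.equivFunOnFinite.symm (![(l'.1 : ℕ), (l'.2.1 : ℕ), (l'.2.2 : ℕ)] : Fin 3 → ℕ))
        ((p l' : ℤ) : ℂ)).coeff m = 0 := by
  classical
  simp only [MvPolynomial.coeff_sum, MvPolynomial.coeff_monomial]
  exact Finset.sum_eq_zero fun l _ => if_neg (hm l)

/-- `P ≠ 0` as soon as some `p(a,b,c) ≠ 0`. [folklore] -/
theorem auxP_ne_zero (p : Fin D₀ × Fin D₁ × Fin D₁ → ℤ) (hp : p ≠ 0) :
    (∑ l', MvPolynomial.monomial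
        (Finsupp.equivFunOnFinite.symm (![(l'.1 : ℕ), (l'.2.1 : ℕ), (l'.2.2 : ℕ)] : Fin 3 → ℕ))
        ((p l' : ℤ) : ℂ)) ≠ 0 := by
  obtain ⟨l, hl⟩ := Function.ne_iff.mp hp
  intro h0
  have := coeff_auxP p l
  rw [h0, MvPolynomial.coeff_zero] at this
  exact hl (by exact_mod_cast this.symm)

/-- Partial degrees of `P`: `deg_{X_i} P` is bounded by the range of the `i`-th exponent.
[folklore] -/
theorem degreeOf_auxP_le (p : Fin D₀ × Fin D₁ × Fin D₁ → ℤ) (i : Fin 3) (N : ℕ)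
    (hN : ∀ l : Fin D₀ × Fin D₁ × Fin D₁, (![(l.1 : ℕ), (l.2.1 : ℕ), (l.2.2 : ℕ)] : Fin 3 → ℕ) i ≤ N) :
    (∑ l', MvPolynomial.monomial
        (Finsupp.equivFunOnFinite.symm (![(l'.1 : ℕ), (l'.2.1 : ℕ), (l'.2.2 : ℕ)] : Fin 3 → ℕ))
        ((p l' : ℤ) : ℂ)).degreeOf i ≤ N := by
  classical
  rw [MvPolynomial.degreeOf_le_iff]
  intro m hm
  by_contra hlt
  push Not at hlt
  have hne : ∀ l : Fin D₀ × Fin D₁ × Fin D₁,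
      Finsupp.equivFunOnFinite.symm (![(l.1 : ℕ), (l.2.1 : ℕ), (l.2.2 : ℕ)] : Fin 3 → ℕ) ≠ m := by
    intro l h
    have := hN l
    rw [← h, Finsupp.coe_equivFunOnFinite_symm] at hlt
    omega
  exact (MvPolynomial.mem_support_iff.mp hm) (coeff_auxP_eq_zero p m hne)

/-- `deg_{X₀} P ≤ D₀ - 1`, `deg_{X₁} P, deg_{X₂} P ≤ D₁ - 1`. [folklore] -/
theorem degreeOf_auxP (p : Fin D₀ × Fin D₁ × Fin D₁ → ℤ) :
    (∑ l', MvPolynomial.monomial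
        (Finsupp.equivFunOnFinite.symm (![(l'.1 : ℕ), (l'.2.1 : ℕ), (l'.2.2 : ℕ)] : Fin 3 → ℕ))
        ((p l' : ℤ) : ℂ)).degreeOf 0 ≤ D₀ - 1 ∧
    ∀ h : Fin 2, (∑ l', MvPolynomial.monomial
        (Finsupp.equivFunOnFinite.symm (![(l'.1 : ℕ), (l'.2.1 : ℕ), (l'.2.2 : ℕ)] : Fin 3 → ℕ))
        ((p l' : ℤ) : ℂ)).degreeOf h.succ ≤ D₁ - 1 := by
  refine ⟨degreeOf_auxP_le p 0 _ fun l => ?_, fun h => degreeOf_auxP_le p h.succ _ fun l => ?_⟩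
  · have := l.1.isLt
    simp only [Matrix.cons_val_zero]
    omega
  · fin_cases h
    · have := l.2.1.isLt
      simp only [Fin.zero_eta, Fin.succ_zero_eq_one, Matrix.cons_val_one, Matrix.cons_val_zero]
      omega
    · have := l.2.2.isLt
      simp only [Fin.mk_one, Fin.succ_one_eq_two, Matrix.cons_val]
      omega

/-- Evaluation: `P(f₀, f₁, f₂) = ∑ p(a,b,c) f₀^a f₁^b f₂^c`. [folklore] -/
theorem eval_auxP (p : Fin D₀ × Fin D₁ × Fin D₁ → ℤ) (f : Fin 3 → ℂ) :
    MvPolynomial.eval f (∑ l', MvPolynomial.monomial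
        (Finsupp.equivFunOnFinite.symm (![(l'.1 : ℕ), (l'.2.1 : ℕ), (l'.2.2 : ℕ)] : Fin 3 → ℕ))
        ((p l' : ℤ) : ℂ)) =
      ∑ l : Fin D₀ × Fin D₁ × Fin D₁,
        (p l : ℂ) * (f 0 ^ (l.1 : ℕ) * f 1 ^ (l.2.1 : ℕ) * f 2 ^ (l.2.2 : ℕ)) := by
  simp only [map_sum, MvPolynomial.eval_monomial]
  refine Finset.sum_congr rfl fun l _ => ?_
  congr 1
  rw [Finsupp.prod_fintype _ _ fun i => pow_zero _]
  simp [Fin.prod_univ_three]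

end AuxPoly

/-! ### `P` along `σ(μ) · exp_G(τ(1; -1, 0))` is the auxiliary function -/

/-- The point `σ(μ) · exp_G(τ(1;-1,0))` in coordinates:
`(μ₂γ + τ; e^{γ(μ₀y₀+μ₁y₁)} e^{-τ}, e^{λ(μ₀y₀+μ₁y₁+μ₂)})`. [folklore] -/
theorem coord_sig_mul_exp (γ lam : ℂ) (y : Fin 2 → ℂ) (μ : Fin 3 → ℕ) (τ : ℂ) :
    coord (sig (![0, 0, γ] : Fin 3 → ℂ)
        (![![γ * y 0, γ * y 1, 0], ![lam * y 0, lam * y 1, lam]] : Fin 2 → Fin 3 → ℂ)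
        (fun k => (μ k : ℤ)) * GaGm.exp (τ • ((1 : ℂ), (![-1, 0] : Fin 2 → ℂ)))) =
      ![(μ 2 : ℂ) * γ + τ, cexp (γ * ((μ 0 : ℂ) * y 0 + (μ 1 : ℂ) * y 1) - τ),
        cexp (lam * ((μ 0 : ℂ) * y 0 + (μ 1 : ℂ) * y 1 + (μ 2 : ℂ)))] := by
  rw [sig, ← GaGm.exp_add, coord_exp]
  have h1 : (wv (![0, 0, γ] : Fin 3 → ℂ)
      (![![γ * y 0, γ * y 1, 0], ![lam * y 0, lam * y 1, lam]] : Fin 2 → Fin 3 → ℂ)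
      (fun k => (μ k : ℤ)) + τ • ((1 : ℂ), (![-1, 0] : Fin 2 → ℂ))).1 = (μ 2 : ℂ) * γ + τ := by
    simp [wv, Fin.sum_univ_three]
  have h2 : (wv (![0, 0, γ] : Fin 3 → ℂ)
      (![![γ * y 0, γ * y 1, 0], ![lam * y 0, lam * y 1, lam]] : Fin 2 → Fin 3 → ℂ)
      (fun k => (μ k : ℤ)) + τ • ((1 : ℂ), (![-1, 0] : Fin 2 → ℂ))).2 0 =
      γ * ((μ 0 : ℂ) * y 0 + (μ 1 : ℂ) * y 1) - τ := by
    simp [wv, Fin.sum_univ_three, Matrix.vecHead, Matrix.vecTail]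
    ring
  have h3 : (wv (![0, 0, γ] : Fin 3 → ℂ)
      (![![γ * y 0, γ * y 1, 0], ![lam * y 0, lam * y 1, lam]] : Fin 2 → Fin 3 → ℂ)
      (fun k => (μ k : ℤ)) + τ • ((1 : ℂ), (![-1, 0] : Fin 2 → ℂ))).2 1 =
      lam * ((μ 0 : ℂ) * y 0 + (μ 1 : ℂ) * y 1 + (μ 2 : ℂ)) := by
    simp [wv, Fin.sum_univ_three, Matrix.vecHead, Matrix.vecTail]
    ring
  ext i
  refine Fin.cases ?_ (fun j => ?_) i
  · rw [Fin.cons_zero, h1]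
    rfl
  · rw [Fin.cons_succ]
    fin_cases j
    · rw [show ((⟨0, by norm_num⟩ : Fin 2)) = 0 from rfl, h2]
      rfl
    · rw [show ((⟨1, by norm_num⟩ : Fin 2)) = 1 from rfl, h3]
      rfl

/-- **Along `σ(μ)·exp_G(τ(1;-1,0))` the polynomial `P` is the auxiliary function**:
`P(σ(μ)·exp_G(τ(1;-1,0))) = F(s_μ, w_μ + τ)` with `s_μ = γ(μ₀y₀+μ₁y₁+μ₂)`, `w_μ = μ₂γ`,
`κ = λ/γ` (`γ ≠ 0`). [folklore] -/
theorem evalAt_auxP_sig_mul_exp {γ : ℂ} (hγ : γ ≠ 0) (lam : ℂ) (y : Fin 2 → ℂ) {D₀ D₁ : ℕ}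
    (p : Fin D₀ × Fin D₁ × Fin D₁ → ℤ) (μ : Fin 3 → ℕ) (τ : ℂ) :
    evalAt (∑ l', MvPolynomial.monomial
        (Finsupp.equivFunOnFinite.symm (![(l'.1 : ℕ), (l'.2.1 : ℕ), (l'.2.2 : ℕ)] : Fin 3 → ℕ))
        ((p l' : ℤ) : ℂ))
      (sig (![0, 0, γ] : Fin 3 → ℂ)
        (![![γ * y 0, γ * y 1, 0], ![lam * y 0, lam * y 1, lam]] : Fin 2 → Fin 3 → ℂ)
        (fun k => (μ k : ℤ)) * GaGm.exp (τ • ((1 : ℂ), (![-1, 0] : Fin 2 → ℂ)))) =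
      ∑ l : Fin D₀ × Fin D₁ × Fin D₁, (p l : ℂ) * (((μ 2 : ℂ) * γ + τ) ^ (l.1 : ℕ) *
        cexp ((-(((l.2.1 : ℕ) : ℂ))) * ((μ 2 : ℂ) * γ + τ)) *
        cexp ((((l.2.1 : ℕ) : ℂ) + ((l.2.2 : ℕ) : ℂ) * (lam / γ)) *
          (γ * ((μ 0 : ℂ) * y 0 + (μ 1 : ℂ) * y 1 + (μ 2 : ℂ))))) := by
  rw [evalAt, coord_sig_mul_exp, eval_auxP]
  refine Finset.sum_congr rfl fun l _ => ?_
  congr 1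
  have e0 : (![(μ 2 : ℂ) * γ + τ, cexp (γ * ((μ 0 : ℂ) * y 0 + (μ 1 : ℂ) * y 1) - τ),
      cexp (lam * ((μ 0 : ℂ) * y 0 + (μ 1 : ℂ) * y 1 + (μ 2 : ℂ)))] : Fin 3 → ℂ) 0 =
      (μ 2 : ℂ) * γ + τ := rfl
  have e1 : (![(μ 2 : ℂ) * γ + τ, cexp (γ * ((μ 0 : ℂ) * y 0 + (μ 1 : ℂ) * y 1) - τ),
      cexp (lam * ((μ 0 : ℂ) * y 0 + (μ 1 : ℂ) * y 1 + (μ 2 : ℂ)))] : Fin 3 → ℂ) 1 =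
      cexp (γ * ((μ 0 : ℂ) * y 0 + (μ 1 : ℂ) * y 1) - τ) := rfl
  have e2 : (![(μ 2 : ℂ) * γ + τ, cexp (γ * ((μ 0 : ℂ) * y 0 + (μ 1 : ℂ) * y 1) - τ),
      cexp (lam * ((μ 0 : ℂ) * y 0 + (μ 1 : ℂ) * y 1 + (μ 2 : ℂ)))] : Fin 3 → ℂ) 2 =
      cexp (lam * ((μ 0 : ℂ) * y 0 + (μ 1 : ℂ) * y 1 + (μ 2 : ℂ))) := rfl
  rw [e0, e1, e2, mul_assoc, mul_assoc]
  congr 1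
  rw [← Complex.exp_nat_mul, ← Complex.exp_nat_mul, ← Complex.exp_add, ← Complex.exp_add]
  congr 1
  field_simp
  ring

/-! ### The derivatives as values of integer polynomials -/

section Deriv

variable (G : AlgGens) (i₀ i₁ i₂ i₃ i₄ i₅ : G.ι)

/-- The symbolic derivative factor evaluates to `(step_{-b}^t X^a)(μ₂γ)`. [folklore] -/
theorem aeval_stepEval (t a b m₂ : ℕ) :
    MvPolynomial.aeval G.a
      (Polynomial.eval (((m₂ : ℕ) : MvPolynomial G.ι ℤ) * MvPolynomial.X i₀)
        ((step (-((b : ℕ) : MvPolynomial G.ι ℤ)))^[t]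
          ((Polynomial.X : Polynomial (MvPolynomial G.ι ℤ)) ^ a))) =
      Polynomial.eval (((m₂ : ℕ) : ℂ) * G.a i₀)
        ((step (-((b : ℕ) : ℂ)))^[t] ((Polynomial.X : Polynomial ℂ) ^ a)) := by
  set φ : MvPolynomial G.ι ℤ →+* ℂ := (MvPolynomial.aeval G.a).toRingHom with hφ
  have hφY : φ (((m₂ : ℕ) : MvPolynomial G.ι ℤ) * MvPolynomial.X i₀) = ((m₂ : ℕ) : ℂ) * G.a i₀ := by
    simp [hφ]
  have hφW : φ (-((b : ℕ) : MvPolynomial G.ι ℤ)) = -((b : ℕ) : ℂ) := by simp [hφ]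
  change φ (Polynomial.eval₂ (RingHom.id _) (((m₂ : ℕ) : MvPolynomial G.ι ℤ) * MvPolynomial.X i₀)
    ((step (-((b : ℕ) : MvPolynomial G.ι ℤ)))^[t]
      ((Polynomial.X : Polynomial (MvPolynomial G.ι ℤ)) ^ a))) = _
  rw [Polynomial.hom_eval₂, RingHom.comp_id, ← Polynomial.eval_map, hφY, iterate_step_map, hφW,
    Polynomial.map_pow, Polynomial.map_X]

/-- `(d/dτ)^t [(w₀ + τ)^a e^{-b(w₀+τ)}]|_{τ=0} = (step_{-b}^t X^a)(w₀) · e^{-bw₀}`.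
[cite: Baker1975, Ch. 12 §5 (value polynomials)] -/
theorem iteratedDeriv_pow_mul_exp (a b t : ℕ) (w₀ : ℂ) :
    iteratedDeriv t (fun τ : ℂ => (w₀ + τ) ^ a * cexp ((-((b : ℕ) : ℂ)) * (w₀ + τ))) 0 =
      Polynomial.eval w₀ ((step (-((b : ℕ) : ℂ)))^[t] ((Polynomial.X : Polynomial ℂ) ^ a)) *
        cexp ((-((b : ℕ) : ℂ)) * w₀) := by
  have hfun : (fun τ : ℂ => (w₀ + τ) ^ a * cexp ((-((b : ℕ) : ℂ)) * (w₀ + τ))) =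
      fun τ => expMono (-((b : ℕ) : ℂ)) ((Polynomial.X : Polynomial ℂ) ^ a) (w₀ + τ) := by
    funext τ
    simp [expMono]
  rw [hfun, iteratedDeriv_comp_const_add t (expMono (-((b : ℕ) : ℂ))
    ((Polynomial.X : Polynomial ℂ) ^ a)) w₀]
  simp only [add_zero]
  rw [iteratedDeriv_expMono]
  simp [expMono]

/-- **The derivatives of `F(s_μ, w_μ + τ)` at `τ = 0` are values of integer polynomials.** With
letters `i₀, …, i₅` of `G` standing for `γ, e^{γy₀}, e^{γy₁}, e^{λy₀}, e^{λy₁}, e^{λ}`: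
`(d/dτ)^t F(s_μ, w_μ+τ)|₀ = Q_{t,μ}(G.a)`,
`Q_{t,μ} = ∑ p(a,b,c) (step_{-b}^t X^a)(μ₂X_{i₀}) X_{i₁}^{bμ₀}X_{i₂}^{bμ₁}X_{i₃}^{cμ₀}X_{i₄}^{cμ₁}X_{i₅}^{cμ₂}`.
[cite: Waldschmidt1988, §6 (values of the derivatives at the points of Γ(S))] -/
theorem iteratedDeriv_F_eq_aeval {γ lam : ℂ} {y : Fin 2 → ℂ} (hγ : γ ≠ 0)
    (h₀ : G.a i₀ = γ) (h₁ : G.a i₁ = cexp (γ * y 0)) (h₂ : G.a i₂ = cexp (γ * y 1))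
    (h₃ : G.a i₃ = cexp (lam * y 0)) (h₄ : G.a i₄ = cexp (lam * y 1)) (h₅ : G.a i₅ = cexp lam)
    {D₀ D₁ : ℕ} (p : Fin D₀ × Fin D₁ × Fin D₁ → ℤ) (μ : Fin 3 → ℕ) (t : ℕ) :
    iteratedDeriv t (fun τ : ℂ => ∑ l : Fin D₀ × Fin D₁ × Fin D₁, (p l : ℂ) *
      (((μ 2 : ℂ) * γ + τ) ^ (l.1 : ℕ) *
        cexp ((-(((l.2.1 : ℕ) : ℂ))) * ((μ 2 : ℂ) * γ + τ)) *
        cexp ((((l.2.1 : ℕ) : ℂ) + ((l.2.2 : ℕ) : ℂ) * (lam / γ)) *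
          (γ * ((μ 0 : ℂ) * y 0 + (μ 1 : ℂ) * y 1 + (μ 2 : ℂ)))))) 0 =
    MvPolynomial.aeval G.a (∑ l : Fin D₀ × Fin D₁ × Fin D₁,
      MvPolynomial.C (p l) *
        Polynomial.eval (((μ 2 : ℕ) : MvPolynomial G.ι ℤ) * MvPolynomial.X i₀)
          ((step (-(((l.2.1 : ℕ)) : MvPolynomial G.ι ℤ)))^[t]
            ((Polynomial.X : Polynomial (MvPolynomial G.ι ℤ)) ^ (l.1 : ℕ))) *
        (MvPolynomial.X i₁ ^ ((l.2.1 : ℕ) * μ 0) * MvPolynomial.X i₂ ^ ((l.2.1 : ℕ) * μ 1) *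
          MvPolynomial.X i₃ ^ ((l.2.2 : ℕ) * μ 0) * MvPolynomial.X i₄ ^ ((l.2.2 : ℕ) * μ 1) *
          MvPolynomial.X i₅ ^ ((l.2.2 : ℕ) * μ 2))) := by
  set w₀ : ℂ := (μ 2 : ℂ) * γ with hw₀
  set s₀ : ℂ := γ * ((μ 0 : ℂ) * y 0 + (μ 1 : ℂ) * y 1 + (μ 2 : ℂ)) with hs₀
  -- reorganise each term as `C_l · g_l(w₀ + τ)`
  have hfun : (fun τ : ℂ => ∑ l : Fin D₀ × Fin D₁ × Fin D₁, (p l : ℂ) *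
      ((w₀ + τ) ^ (l.1 : ℕ) * cexp ((-(((l.2.1 : ℕ) : ℂ))) * (w₀ + τ)) *
        cexp ((((l.2.1 : ℕ) : ℂ) + ((l.2.2 : ℕ) : ℂ) * (lam / γ)) * s₀))) =
      fun τ => ∑ l : Fin D₀ × Fin D₁ × Fin D₁,
        ((p l : ℂ) * cexp ((((l.2.1 : ℕ) : ℂ) + ((l.2.2 : ℕ) : ℂ) * (lam / γ)) * s₀)) *
          ((w₀ + τ) ^ (l.1 : ℕ) * cexp ((-(((l.2.1 : ℕ) : ℂ))) * (w₀ + τ))) := by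
    funext τ
    refine Finset.sum_congr rfl fun l _ => ?_
    ring
  rw [hfun, iteratedDeriv_fun_sum fun l _ => by
    have : ContDiff ℂ t (fun τ : ℂ => (w₀ + τ) ^ (l.1 : ℕ) *
        cexp ((-(((l.2.1 : ℕ) : ℂ))) * (w₀ + τ))) := by fun_prop
    exact (contDiff_const.mul this).contDiffAt]
  simp_rw [iteratedDeriv_const_mul_field, iteratedDeriv_pow_mul_exp]
  rw [map_sum]
  refine Finset.sum_congr rfl fun l _ => ?_
  rw [map_mul, map_mul, aeval_stepEval, MvPolynomial.aeval_C]
  simp only [map_mul, map_pow, MvPolynomial.aeval_X, h₀, h₁, h₂, h₃, h₄, h₅, algebraMap_int_eq,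
    eq_intCast]
  -- the exponential factors
  have hexp : cexp ((((l.2.1 : ℕ) : ℂ) + ((l.2.2 : ℕ) : ℂ) * (lam / γ)) * s₀) *
      cexp ((-(((l.2.1 : ℕ) : ℂ))) * w₀) =
      cexp (γ * y 0) ^ ((l.2.1 : ℕ) * μ 0) * cexp (γ * y 1) ^ ((l.2.1 : ℕ) * μ 1) *
        cexp (lam * y 0) ^ ((l.2.2 : ℕ) * μ 0) * cexp (lam * y 1) ^ ((l.2.2 : ℕ) * μ 1) *
        cexp lam ^ ((l.2.2 : ℕ) * μ 2) := by
    rw [← Complex.exp_nat_mul, ← Complex.exp_nat_mul, ← Complex.exp_nat_mul,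
      ← Complex.exp_nat_mul, ← Complex.exp_nat_mul, ← Complex.exp_add, ← Complex.exp_add,
      ← Complex.exp_add, ← Complex.exp_add, ← Complex.exp_add]
    congr 1
    rw [hs₀, hw₀]
    push_cast
    field_simp
    ring
  have hm₂ : (((μ 2 : ℕ) : ℂ)) * γ = w₀ := by rw [hw₀]
  rw [hm₂]
  calc (p l : ℂ) * cexp ((((l.2.1 : ℕ) : ℂ) + ((l.2.2 : ℕ) : ℂ) * (lam / γ)) * s₀) *
        (Polynomial.eval w₀ ((step (-(((l.2.1 : ℕ)) : ℂ)))^[t]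
          ((Polynomial.X : Polynomial ℂ) ^ (l.1 : ℕ))) * cexp ((-(((l.2.1 : ℕ) : ℂ))) * w₀))
      = (p l : ℂ) * Polynomial.eval w₀ ((step (-(((l.2.1 : ℕ)) : ℂ)))^[t]
          ((Polynomial.X : Polynomial ℂ) ^ (l.1 : ℕ))) *
        (cexp ((((l.2.1 : ℕ) : ℂ) + ((l.2.2 : ℕ) : ℂ) * (lam / γ)) * s₀) *
          cexp ((-(((l.2.1 : ℕ) : ℂ))) * w₀)) := by ring
    _ = _ := by rw [hexp]

/-- Degree of the symbolic derivative factor: `deg (step_{-b}^t X^a)(μ₂X_{i₀}) ≤ t + a`.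
[folklore] -/
theorem totalDegree_stepEval_le (t a b m₂ : ℕ) :
    (Polynomial.eval (((m₂ : ℕ) : MvPolynomial G.ι ℤ) * MvPolynomial.X i₀)
        ((step (-((b : ℕ) : MvPolynomial G.ι ℤ)))^[t]
          ((Polynomial.X : Polynomial (MvPolynomial G.ι ℤ)) ^ a))).totalDegree ≤ t + a := by
  have hW : (-((b : ℕ) : MvPolynomial G.ι ℤ)).totalDegree ≤ 1 := by
    rw [MvPolynomial.totalDegree_neg, totalDegree_natCast]
    exact Nat.zero_le _
  have hY : (((m₂ : ℕ) : MvPolynomial G.ι ℤ) * MvPolynomial.X i₀).totalDegree ≤ 1 := by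
    refine (MvPolynomial.totalDegree_mul _ _).trans ?_
    rw [totalDegree_natCast, zero_add]
    exact (MvPolynomial.totalDegree_X _).le
  have hQ : ∀ k, (((step (-((b : ℕ) : MvPolynomial G.ι ℤ)))^[t]
      ((Polynomial.X : Polynomial (MvPolynomial G.ι ℤ)) ^ a)).coeff k).totalDegree ≤ t := by
    induction t with
    | zero =>
      intro k
      simp only [Function.iterate_zero, id_eq, Polynomial.coeff_X_pow]
      split_ifs <;> simp
    | succ t ih =>
      intro k
      rw [Function.iterate_succ_apply']
      exact totalDegree_coeff_step_le hW ih k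
  exact totalDegree_eval_le hY hQ ((natDegree_iterate_step_le _ _ _).trans
    (Polynomial.natDegree_X_pow_le a))

/-- Length of the symbolic derivative factor: `L((step_{-b}^t X^a)(μ₂X_{i₀})) ≤ (a+b)^t (μ₂+1)^a`.
[folklore] -/
theorem l1_stepEval_le (t a b m₂ : ℕ) :
    l1 (Polynomial.eval (((m₂ : ℕ) : MvPolynomial G.ι ℤ) * MvPolynomial.X i₀)
        ((step (-((b : ℕ) : MvPolynomial G.ι ℤ)))^[t]
          ((Polynomial.X : Polynomial (MvPolynomial G.ι ℤ)) ^ a))) ≤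
      ((a : ℝ) + b) ^ t * ((m₂ : ℝ) + 1) ^ a := by
  have hWl : l1 (-((b : ℕ) : MvPolynomial G.ι ℤ)) = b := by
    change wnorm (normRingSeminorm ℤ) (-((b : ℕ) : MvPolynomial G.ι ℤ)) = b
    rw [Literature.NumberTheory.Transcendental.Chudnovsky.wnorm_neg]
    exact l1_natCast b
  have hplen : plen ((step (-((b : ℕ) : MvPolynomial G.ι ℤ)))^[t]
      ((Polynomial.X : Polynomial (MvPolynomial G.ι ℤ)) ^ a)) ≤ ((a : ℝ) + b) ^ t := by
    induction t with
    | zero =>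
      simp only [Function.iterate_zero, id_eq, pow_zero]
      change pwnorm _ ((Polynomial.X : Polynomial (MvPolynomial G.ι ℤ)) ^ a) ≤ 1
      rw [show ((Polynomial.X : Polynomial (MvPolynomial G.ι ℤ)) ^ a) = Polynomial.monomial a 1 by
        rw [Polynomial.X_pow_eq_monomial],
        Literature.NumberTheory.Transcendental.Chudnovsky.pwnorm_monomial]
      exact l1Seminorm_one_le
    | succ t ih =>
      rw [Function.iterate_succ_apply']
      refine (plen_step_le _ _).trans ?_
      have hdeg : (((step (-((b : ℕ) : MvPolynomial G.ι ℤ)))^[t]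
          ((Polynomial.X : Polynomial (MvPolynomial G.ι ℤ)) ^ a)).natDegree : ℝ) ≤ a := by
        exact_mod_cast (natDegree_iterate_step_le _ _ _).trans (Polynomial.natDegree_X_pow_le a)
      have h0 : 0 ≤ plen ((step (-((b : ℕ) : MvPolynomial G.ι ℤ)))^[t]
          ((Polynomial.X : Polynomial (MvPolynomial G.ι ℤ)) ^ a)) := pwnorm_nonneg _ _
      rw [hWl]
      calc (((step (-((b : ℕ) : MvPolynomial G.ι ℤ)))^[t]
              ((Polynomial.X : Polynomial (MvPolynomial G.ι ℤ)) ^ a)).natDegree + (b : ℝ)) *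
            plen ((step (-((b : ℕ) : MvPolynomial G.ι ℤ)))^[t]
              ((Polynomial.X : Polynomial (MvPolynomial G.ι ℤ)) ^ a))
          ≤ ((a : ℝ) + b) * ((a : ℝ) + b) ^ t :=
            mul_le_mul (add_le_add hdeg le_rfl) ih h0 (by positivity)
        _ = ((a : ℝ) + b) ^ (t + 1) := by ring
  have hY : l1 (((m₂ : ℕ) : MvPolynomial G.ι ℤ) * MvPolynomial.X i₀) ≤ (m₂ : ℝ) + 1 := by
    refine (wnorm_mul_le _ _ _).trans ?_
    change l1 _ * l1 _ ≤ _
    rw [l1_natCast, l1_X, mul_one]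
    linarith
  have hM1 : (1 : ℝ) ≤ (m₂ : ℝ) + 1 := le_add_of_nonneg_left (Nat.cast_nonneg _)
  have hev := l1_eval_le ((step (-((b : ℕ) : MvPolynomial G.ι ℤ)))^[t]
    ((Polynomial.X : Polynomial (MvPolynomial G.ι ℤ)) ^ a))
    (M := (m₂ : ℝ) + 1) hM1 hY ((natDegree_iterate_step_le _ _ _).trans
      (Polynomial.natDegree_X_pow_le a))
  exact hev.trans (mul_le_mul_of_nonneg_right hplen (by positivity))

/-- **Degree of `Q_{t,μ}`**: `≤ t + D₀ + 5D₁M₃` when `max μ_k ≤ M₃`. [folklore] -/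
theorem totalDegree_Q_le {D₀ D₁ : ℕ} (p : Fin D₀ × Fin D₁ × Fin D₁ → ℤ) {M₃ : ℕ} (μ : Fin 3 → ℕ)
    (hμ : ∀ k, μ k ≤ M₃) (t : ℕ) :
    (∑ l : Fin D₀ × Fin D₁ × Fin D₁,
      MvPolynomial.C (p l) *
        Polynomial.eval (((μ 2 : ℕ) : MvPolynomial G.ι ℤ) * MvPolynomial.X i₀)
          ((step (-(((l.2.1 : ℕ)) : MvPolynomial G.ι ℤ)))^[t]
            ((Polynomial.X : Polynomial (MvPolynomial G.ι ℤ)) ^ (l.1 : ℕ))) *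
        (MvPolynomial.X i₁ ^ ((l.2.1 : ℕ) * μ 0) * MvPolynomial.X i₂ ^ ((l.2.1 : ℕ) * μ 1) *
          MvPolynomial.X i₃ ^ ((l.2.2 : ℕ) * μ 0) * MvPolynomial.X i₄ ^ ((l.2.2 : ℕ) * μ 1) *
          MvPolynomial.X i₅ ^ ((l.2.2 : ℕ) * μ 2))).totalDegree ≤ t + D₀ + 5 * D₁ * M₃ := by
  refine MvPolynomial.totalDegree_finsetSum_le fun l _ => ?_
  have hXpow : ∀ (i : G.ι) (n : ℕ), (MvPolynomial.X i ^ n : MvPolynomial G.ι ℤ).totalDegree ≤ n :=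
    fun i n => (MvPolynomial.totalDegree_pow _ _).trans
      (mul_le_of_le_one_right (Nat.zero_le _) (MvPolynomial.totalDegree_X _).le)
  have ha : (l.1 : ℕ) ≤ D₀ := l.1.isLt.le
  have hb : (l.2.1 : ℕ) ≤ D₁ := l.2.1.isLt.le
  have hc : (l.2.2 : ℕ) ≤ D₁ := l.2.2.isLt.le
  have hb0 : (l.2.1 : ℕ) * μ 0 ≤ D₁ * M₃ := Nat.mul_le_mul hb (hμ 0)
  have hb1 : (l.2.1 : ℕ) * μ 1 ≤ D₁ * M₃ := Nat.mul_le_mul hb (hμ 1)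
  have hc0 : (l.2.2 : ℕ) * μ 0 ≤ D₁ * M₃ := Nat.mul_le_mul hc (hμ 0)
  have hc1 : (l.2.2 : ℕ) * μ 1 ≤ D₁ * M₃ := Nat.mul_le_mul hc (hμ 1)
  have hc2 : (l.2.2 : ℕ) * μ 2 ≤ D₁ * M₃ := Nat.mul_le_mul hc (hμ 2)
  calc _ ≤ (MvPolynomial.C (p l) *
          Polynomial.eval (((μ 2 : ℕ) : MvPolynomial G.ι ℤ) * MvPolynomial.X i₀)
            ((step (-(((l.2.1 : ℕ)) : MvPolynomial G.ι ℤ)))^[t]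
              ((Polynomial.X : Polynomial (MvPolynomial G.ι ℤ)) ^ (l.1 : ℕ)))).totalDegree +
          (MvPolynomial.X i₁ ^ ((l.2.1 : ℕ) * μ 0) * MvPolynomial.X i₂ ^ ((l.2.1 : ℕ) * μ 1) *
            MvPolynomial.X i₃ ^ ((l.2.2 : ℕ) * μ 0) * MvPolynomial.X i₄ ^ ((l.2.2 : ℕ) * μ 1) *
            MvPolynomial.X i₅ ^ ((l.2.2 : ℕ) * μ 2)).totalDegree := MvPolynomial.totalDegree_mul _ _
    _ ≤ (0 + (t + (l.1 : ℕ))) + ((l.2.1 : ℕ) * μ 0 + (l.2.1 : ℕ) * μ 1 + (l.2.2 : ℕ) * μ 0 +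
          (l.2.2 : ℕ) * μ 1 + (l.2.2 : ℕ) * μ 2) := by
        refine Nat.add_le_add ((MvPolynomial.totalDegree_mul _ _).trans (Nat.add_le_add
          (MvPolynomial.totalDegree_C _).le (totalDegree_stepEval_le G i₀ t _ _ _))) ?_
        refine (MvPolynomial.totalDegree_mul _ _).trans (Nat.add_le_add ?_ (hXpow _ _))
        refine (MvPolynomial.totalDegree_mul _ _).trans (Nat.add_le_add ?_ (hXpow _ _))
        refine (MvPolynomial.totalDegree_mul _ _).trans (Nat.add_le_add ?_ (hXpow _ _))
        exact (MvPolynomial.totalDegree_mul _ _).trans (Nat.add_le_add (hXpow _ _) (hXpow _ _))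
    _ ≤ t + D₀ + 5 * D₁ * M₃ := by nlinarith

/-- **Length of `Q_{t,μ}`**: `≤ D₀D₁²·P_b·(D₀+D₁)^t·(M₃+1)^{D₀}` when `|p| ≤ P_b`, `max μ_k ≤ M₃`.
[folklore] -/
theorem l1_Q_le {D₀ D₁ : ℕ} (p : Fin D₀ × Fin D₁ × Fin D₁ → ℤ) {Pb : ℕ} (hp : ∀ l, |p l| ≤ Pb)
    {M₃ : ℕ} (μ : Fin 3 → ℕ) (hμ : ∀ k, μ k ≤ M₃) (t : ℕ) :
    l1 (∑ l : Fin D₀ × Fin D₁ × Fin D₁,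
      MvPolynomial.C (p l) *
        Polynomial.eval (((μ 2 : ℕ) : MvPolynomial G.ι ℤ) * MvPolynomial.X i₀)
          ((step (-(((l.2.1 : ℕ)) : MvPolynomial G.ι ℤ)))^[t]
            ((Polynomial.X : Polynomial (MvPolynomial G.ι ℤ)) ^ (l.1 : ℕ))) *
        (MvPolynomial.X i₁ ^ ((l.2.1 : ℕ) * μ 0) * MvPolynomial.X i₂ ^ ((l.2.1 : ℕ) * μ 1) *
          MvPolynomial.X i₃ ^ ((l.2.2 : ℕ) * μ 0) * MvPolynomial.X i₄ ^ ((l.2.2 : ℕ) * μ 1) *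
          MvPolynomial.X i₅ ^ ((l.2.2 : ℕ) * μ 2))) ≤
      (D₀ * (D₁ * D₁) : ℝ) * Pb * (((D₀ : ℝ) + D₁) ^ t * ((M₃ : ℝ) + 1) ^ D₀) := by
  have hν1 : normRingSeminorm ℤ 1 ≤ 1 := by simp
  have hmono : ∀ l : Fin D₀ × Fin D₁ × Fin D₁,
      wnorm (normRingSeminorm ℤ)
        (MvPolynomial.X i₁ ^ ((l.2.1 : ℕ) * μ 0) * MvPolynomial.X i₂ ^ ((l.2.1 : ℕ) * μ 1) *
          MvPolynomial.X i₃ ^ ((l.2.2 : ℕ) * μ 0) * MvPolynomial.X i₄ ^ ((l.2.2 : ℕ) * μ 1) *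
          MvPolynomial.X i₅ ^ ((l.2.2 : ℕ) * μ 2) : MvPolynomial G.ι ℤ) ≤ 1 := by
    intro l
    have hx : ∀ (i : G.ι) (n : ℕ),
        wnorm (normRingSeminorm ℤ) (MvPolynomial.X i ^ n : MvPolynomial G.ι ℤ) ≤ 1 :=
      fun i n => wnorm_X_pow_le _ hν1 _ _
    have hnn : ∀ (P : MvPolynomial G.ι ℤ), 0 ≤ wnorm (normRingSeminorm ℤ) P :=
      fun P => wnorm_nonneg _ _
    refine (wnorm_mul_le _ _ _).trans ?_
    refine mul_le_one₀ ((wnorm_mul_le _ _ _).trans ?_) (hnn _) (hx _ _)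
    refine mul_le_one₀ ((wnorm_mul_le _ _ _).trans ?_) (hnn _) (hx _ _)
    refine mul_le_one₀ ((wnorm_mul_le _ _ _).trans ?_) (hnn _) (hx _ _)
    exact mul_le_one₀ (hx _ _) (hnn _) (hx _ _)
  change wnorm (normRingSeminorm ℤ) _ ≤ _
  refine (wnorm_sum_le _ _ _).trans ?_
  calc _ ≤ ∑ _l : Fin D₀ × Fin D₁ × Fin D₁, (Pb : ℝ) * (((D₀ : ℝ) + D₁) ^ t * ((M₃ : ℝ) + 1) ^ D₀) := by
        refine Finset.sum_le_sum fun l _ => ?_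
        refine (wnorm_mul_le _ _ _).trans ?_
        rw [← mul_one ((Pb : ℝ) * (((D₀ : ℝ) + D₁) ^ t * ((M₃ : ℝ) + 1) ^ D₀))]
        refine mul_le_mul ?_ (hmono l) (wnorm_nonneg _ _) (by positivity)
        refine (wnorm_mul_le _ _ _).trans ?_
        refine mul_le_mul ?_ ?_ (wnorm_nonneg _ _) (Nat.cast_nonneg _)
        · rw [wnorm_C, Literature.NumberTheory.Transcendental.Chudnovsky.normRingSeminorm_int_apply]
          exact_mod_cast hp l
        · refine (l1_stepEval_le G i₀ t _ _ _).trans ?_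
          have ha : ((l.1 : ℕ) : ℝ) ≤ D₀ := by exact_mod_cast l.1.isLt.le
          have hb : ((l.2.1 : ℕ) : ℝ) ≤ D₁ := by exact_mod_cast l.2.1.isLt.le
          have hm : ((μ 2 : ℕ) : ℝ) ≤ M₃ := by exact_mod_cast hμ 2
          have hM1 : (1 : ℝ) ≤ (M₃ : ℝ) + 1 := le_add_of_nonneg_left (Nat.cast_nonneg _)
          calc (((l.1 : ℕ) : ℝ) + ((l.2.1 : ℕ) : ℕ)) ^ t * (((μ 2 : ℕ) : ℝ) + 1) ^ (l.1 : ℕ)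
              ≤ ((D₀ : ℝ) + D₁) ^ t * ((M₃ : ℝ) + 1) ^ (l.1 : ℕ) := by
                gcongr
            _ ≤ ((D₀ : ℝ) + D₁) ^ t * ((M₃ : ℝ) + 1) ^ D₀ := by
                gcongr
                exact l.1.isLt.le
    _ = (D₀ * (D₁ * D₁) : ℝ) * Pb * (((D₀ : ℝ) + D₁) ^ t * ((M₃ : ℝ) + 1) ^ D₀) := by
        rw [Finset.sum_const, Finset.card_univ, Fintype.card_prod, Fintype.card_prod,
          Fintype.card_fin, Fintype.card_fin, nsmul_eq_mul]
        push_cast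
        ring

end Deriv

/-! ### Cauchy's inequality in the direction `W` -/

/-- Cauchy's inequality on the unit circle: if `f` is entire and `‖f‖ ≤ ε` on `|τ| = 1` then
`‖f^{(t)}(0)‖ ≤ t!·ε`. [folklore] -/
theorem norm_iteratedDeriv_le_factorial_mul {f : ℂ → ℂ} (hf : Differentiable ℂ f) {ε : ℝ}
    (hε : ∀ τ : ℂ, ‖τ‖ = 1 → ‖f τ‖ ≤ ε) (t : ℕ) :
    ‖iteratedDeriv t f 0‖ ≤ t.factorial * ε := by
  have h := Complex.norm_iteratedDeriv_le_of_forall_mem_sphere_norm_le (c := 0) (R := 1) t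
    zero_lt_one hf.diffContOnCl fun z hz => hε z (by simpa using hz)
  simpa using h

/-! ### The vanishing of the derivatives -/

set_option maxHeartbeats 800000 in
/-- **The arithmetic step of the direct proof of the five exponentials theorem** (Proposition
6.1 of [Waldschmidt1988] for the configuration of Corollary 2.2, given the small values of part II).
Let `G` be a finite family of algebraic numbers containing
`γ, e^{γy₀}, e^{γy₁}, e^{λy₀}, e^{λy₁}, e^{λ}` (letters `i₀, …, i₅`), `γ ≠ 0`, `κ = λ/γ`. Let
`p(a,b,c)` (`a < D₀`, `b, c < D₁`, `D₀, D₁, P_b ≥ 1`) be integers with `|p| ≤ P_b`, and suppose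
`|F(s,w)| ≤ ε` for `|s|, |w| ≤ R`, where `R ≥ |s_μ|`, `R ≥ |w_μ| + 1` for all `μ` with
`max μ_k ≤ 3B`. If `(3T)!·ε < ((|d|^e · L · M^e)^h)⁻¹` with `e = 3T + D₀ + 15D₁B`,
`L = D₀D₁²P_b(D₀+D₁)^{3T}(3B+1)^{D₀}` and `d, M, h` the denominator, conjugate bound and degree of
`K = ℚ(G)`, then `(d/dτ)^t P(σ(μ)·exp_G(τ(1;-1,0)))|_{τ=0} = 0` for all `t ≤ 3T` and all `μ` with
`max μ_k ≤ 3B`. [cite: Waldschmidt1988, §6 Proposition 6.1 (pp. 388–389)]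
[cite: Baker1975, Ch. 2 Lemma 3 (Liouville's inequality)] -/
theorem derivs_eq_zero (G : AlgGens) (i₀ i₁ i₂ i₃ i₄ i₅ : G.ι) {γ lam : ℂ} {y : Fin 2 → ℂ}
    (hγ : γ ≠ 0) (h₀ : G.a i₀ = γ) (h₁ : G.a i₁ = cexp (γ * y 0)) (h₂ : G.a i₂ = cexp (γ * y 1))
    (h₃ : G.a i₃ = cexp (lam * y 0)) (h₄ : G.a i₄ = cexp (lam * y 1)) (h₅ : G.a i₅ = cexp lam)
    {D₀ D₁ B T Pb : ℕ} (hD₀ : 1 ≤ D₀) (hD₁ : 1 ≤ D₁) (hPb : 1 ≤ Pb)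
    (p : Fin D₀ × Fin D₁ × Fin D₁ → ℤ) (hp : ∀ l, |p l| ≤ Pb) {R ε : ℝ}
    (hR : ∀ μ : Fin 3 → ℕ, (∀ k, μ k ≤ 3 * B) →
      ‖γ * ((μ 0 : ℂ) * y 0 + (μ 1 : ℂ) * y 1 + (μ 2 : ℂ))‖ ≤ R ∧ ‖(μ 2 : ℂ) * γ‖ + 1 ≤ R)
    (hF : ∀ s w : ℂ, ‖s‖ ≤ R → ‖w‖ ≤ R →
      ‖∑ l : Fin D₀ × Fin D₁ × Fin D₁, (p l : ℂ) * (w ^ (l.1 : ℕ) *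
        cexp ((-(((l.2.1 : ℕ) : ℂ))) * w) *
          cexp ((((l.2.1 : ℕ) : ℂ) + ((l.2.2 : ℕ) : ℂ) * (lam / γ)) * s))‖ ≤ ε)
    (hLiou : ((3 * T).factorial : ℝ) * ε <
      ((|(G.den : ℝ)| ^ (3 * T + D₀ + 5 * D₁ * (3 * B)) *
        ((D₀ * (D₁ * D₁) : ℝ) * Pb * (((D₀ : ℝ) + D₁) ^ (3 * T) * ((((3 * B : ℕ) : ℝ)) + 1) ^ D₀)) *
        G.M ^ (3 * T + D₀ + 5 * D₁ * (3 * B))) ^ G.h)⁻¹)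
    (μ : Fin 3 → ℕ) (hμ : ∀ k, μ k ≤ 3 * B) (t : ℕ) (ht : t < 3 * T + 1) :
    iteratedDeriv t (fun τ : ℂ => evalAt (∑ l', MvPolynomial.monomial
        (Finsupp.equivFunOnFinite.symm (![(l'.1 : ℕ), (l'.2.1 : ℕ), (l'.2.2 : ℕ)] : Fin 3 → ℕ))
        ((p l' : ℤ) : ℂ))
      (sig (![0, 0, γ] : Fin 3 → ℂ)
        (![![γ * y 0, γ * y 1, 0], ![lam * y 0, lam * y 1, lam]] : Fin 2 → Fin 3 → ℂ)
        (fun k => (μ k : ℤ)) * GaGm.exp (τ • ((1 : ℂ), (![-1, 0] : Fin 2 → ℂ))))) 0 = 0 := by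
  -- Step 1: the function along the line is `F(s_μ, w_μ + τ)`, whose derivative is `Q_{t,μ}(G.a)`
  simp_rw [evalAt_auxP_sig_mul_exp hγ lam y p μ]
  rw [iteratedDeriv_F_eq_aeval G i₀ i₁ i₂ i₃ i₄ i₅ hγ h₀ h₁ h₂ h₃ h₄ h₅ p μ t]
  -- Step 2: Liouville
  set Lr : ℝ := (D₀ * (D₁ * D₁) : ℝ) * Pb * (((D₀ : ℝ) + D₁) ^ (3 * T) *
    ((((3 * B : ℕ) : ℝ)) + 1) ^ D₀) with hLr
  have hte : t ≤ 3 * T := by omega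
  have h1D : (1 : ℝ) ≤ (D₀ : ℝ) + D₁ := by
    have : (1 : ℝ) ≤ D₀ := by exact_mod_cast hD₀
    have : (0 : ℝ) ≤ D₁ := Nat.cast_nonneg _
    linarith
  refine G.aeval_eq_zero_of_norm_lt _ (e := 3 * T + D₀ + 5 * D₁ * (3 * B))
    ((totalDegree_Q_le G i₀ i₁ i₂ i₃ i₄ i₅ p μ hμ t).trans (by omega)) (L := Lr) ?_ ?_ ?_
  · -- length
    have hl1 := l1_Q_le G i₀ i₁ i₂ i₃ i₄ i₅ p hp μ hμ t
    have hsum : ∀ Q : MvPolynomial G.ι ℤ,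
        ∑ s ∈ Q.support, |((Q.coeff s : ℤ) : ℝ)| = l1 Q := fun Q => by
      simp [Literature.NumberTheory.Transcendental.Chudnovsky.l1,
        Literature.NumberTheory.Transcendental.Chudnovsky.wnorm]
    rw [hsum]
    refine hl1.trans ?_
    rw [hLr]
    exact mul_le_mul_of_nonneg_left (mul_le_mul_of_nonneg_right (pow_le_pow_right₀ h1D hte)
      (by positivity)) (by positivity)
  · -- `1 ≤ L`
    rw [hLr]
    have h2 : (1 : ℝ) ≤ D₁ := by exact_mod_cast hD₁
    have h3 : (1 : ℝ) ≤ Pb := by exact_mod_cast hPb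
    have h5 : (1 : ℝ) ≤ (((3 * B : ℕ) : ℝ)) + 1 := le_add_of_nonneg_left (Nat.cast_nonneg _)
    have h6 : (1 : ℝ) ≤ (D₀ * (D₁ * D₁) : ℝ) := by
      have : (1 : ℝ) ≤ D₀ := by exact_mod_cast hD₀
      nlinarith
    exact one_le_mul_of_one_le_of_one_le (one_le_mul_of_one_le_of_one_le h6 h3)
      (one_le_mul_of_one_le_of_one_le (one_le_pow₀ h1D) (one_le_pow₀ h5))
  · -- the smallness, from Cauchy's inequality
    rw [← iteratedDeriv_F_eq_aeval G i₀ i₁ i₂ i₃ i₄ i₅ hγ h₀ h₁ h₂ h₃ h₄ h₅ p μ t]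
    obtain ⟨hs, hw⟩ := hR μ hμ
    have hdiff : Differentiable ℂ (fun τ : ℂ => ∑ l : Fin D₀ × Fin D₁ × Fin D₁, (p l : ℂ) *
        (((μ 2 : ℂ) * γ + τ) ^ (l.1 : ℕ) *
          cexp ((-(((l.2.1 : ℕ) : ℂ))) * ((μ 2 : ℂ) * γ + τ)) *
          cexp ((((l.2.1 : ℕ) : ℂ) + ((l.2.2 : ℕ) : ℂ) * (lam / γ)) *
            (γ * ((μ 0 : ℂ) * y 0 + (μ 1 : ℂ) * y 1 + (μ 2 : ℂ)))))) := by fun_prop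
    have hcirc : ∀ τ : ℂ, ‖τ‖ = 1 → ‖∑ l : Fin D₀ × Fin D₁ × Fin D₁, (p l : ℂ) *
        (((μ 2 : ℂ) * γ + τ) ^ (l.1 : ℕ) *
          cexp ((-(((l.2.1 : ℕ) : ℂ))) * ((μ 2 : ℂ) * γ + τ)) *
          cexp ((((l.2.1 : ℕ) : ℂ) + ((l.2.2 : ℕ) : ℂ) * (lam / γ)) *
            (γ * ((μ 0 : ℂ) * y 0 + (μ 1 : ℂ) * y 1 + (μ 2 : ℂ)))))‖ ≤ ε := by
      intro τ hτ
      refine hF _ _ hs ?_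
      calc ‖(μ 2 : ℂ) * γ + τ‖ ≤ ‖(μ 2 : ℂ) * γ‖ + ‖τ‖ := norm_add_le _ _
        _ = ‖(μ 2 : ℂ) * γ‖ + 1 := by rw [hτ]
        _ ≤ R := hw
    have hC := norm_iteratedDeriv_le_factorial_mul hdiff hcirc t
    have hε0 : 0 ≤ ε := le_trans (norm_nonneg _) (hcirc 1 (by simp))
    have hfac : (t.factorial : ℝ) ≤ (3 * T).factorial := by
      exact_mod_cast Nat.factorial_le hte
    exact lt_of_le_of_lt (hC.trans (mul_le_mul_of_nonneg_right hfac hε0)) hLiou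

end Literature.NumberTheory.Transcendental.Waldschmidt1988
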